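import Summits.HubbardSuperconductivity.HubbardSuperconductivity.Theorems.BalabanIRBirComplexStableXYRLogConcaveCore
import HarnessLib

/-!
# Crux `BirComplexStableXYR` (stmt-HubbardSuperconductivity-14845), line `fat-gaussian-defect-calculus`:
# stub C7 `stub_imGradientZero` — the imaginary gradient of the window weight vanishes at the constants

Helper (`--supports`) for the crux
`Summit.HubbardSuperconductivity.HubbardSuperconductivity.Theses.BalabanIR.BirComplexStableXYR`, line
`fat-gaussian-defect-calculus` (lead skeleton `Cruxes/BirComplexStableXYR/Lines/fat_gaussian_defect_calculus.lean`),
registered stub C7 `stub_imGradientZero` (chapter 2).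

**Statement.** For a finite Fourier table `c : Table r` on the window `W r` (vocabulary `Table`, `genF` of
`Theorems.BirComplexStableXY.Negative.WitnessTable`) satisfying the crux hypotheses (N) `Σ_n c_n = 0` and
(C) `c₀ ΣΣ (1 − cos(φ_w − φ_w')) ≤ Re F(φ)` with `c₀ > 0`, one has `Σ_n Im(c_n) · n_w = 0` for every window
site `w`.

**Proof.** First-order condition at a minimum.  By (C) `Re F ≥ 0` everywhere (`cos ≤ 1`) and by (N)
`F(0) = Σ c_n = 0`, so the constant configuration `0` is a global minimum of `Re F`.  Along the coordinate
line `s ↦ s·δ_w` the landed line-derivative `cvxr_hasDerivAt_re_genF_line` (`…RLogConcaveCore`) gives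
`d/ds Re F(s δ_w)|₀ = Re Σ_n c_n (n·δ_w) i = −Σ_n Im(c_n) n_w`, and Mathlib's
`IsLocalMin.hasDerivAt_eq_zero` (Fermat) makes it vanish.  No definitions; sorry-free; everything else is
Mathlib. [folklore]
-/

set_option linter.dupNamespace false -- `Summit.<S>.<S>.Theorems…` repeats the summit name (D-0017 layout)

noncomputable section

namespace Summit.HubbardSuperconductivity.HubbardSuperconductivity.Theorems.FSUnfolding

open scoped BigOperators
open Literature.Probability.LatticeModels Summit.HubbardSuperconductivity.BirComplexStableXYNegative

/-- (N) says that `F` vanishes at the constant configuration `0`: `genF c 0 = Σ_n c_n = 0`. [folklore] -/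
theorem imGrad_genF_const_zero {r : ℕ} (c : Table r) (hN : c.sum (fun _ a => a) = 0) :
    genF c (fun _ => 0) = 0 := by
  unfold genF
  simpa using hN

/-- (C) with `c₀ ≥ 0` makes `Re F` non-negative everywhere (`cos ≤ 1`). [folklore] -/
theorem imGrad_re_genF_nonneg {r : ℕ} (c : Table r) {c₀ : ℝ} (hc₀ : 0 ≤ c₀)
    (hC : ∀ φ : W r → ℝ, c₀ * ∑ w, ∑ w', (1 - Real.cos (φ w - φ w')) ≤ (genF c φ).re)
    (φ : W r → ℝ) : 0 ≤ (genF c φ).re :=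
  le_trans (mul_nonneg hc₀ (Finset.sum_nonneg fun _ _ => Finset.sum_nonneg fun _ _ =>
    sub_nonneg.2 (Real.cos_le_one _))) (hC φ)

/-- The frequency pairing with the coordinate direction `δ_w` picks the `w`-th component:
`Σ_w' n_w' · δ_w(w') = n_w`. [folklore] -/
theorem imGrad_frq_delta {r : ℕ} (n : Freq r) (w : W r) :
    (∑ w', (n w' : ℝ) * (if w' = w then (1 : ℝ) else 0)) = (n w : ℝ) := by
  simp [mul_ite, Finset.sum_ite_eq']

/-- Derivative of `Re F` along the coordinate line `s ↦ 0 + s·δ_w` through the constants, at `s = 0`: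
`d/ds Re F(s δ_w)|₀ = −Σ_n Im(c_n) n_w` (the landed `cvxr_hasDerivAt_re_genF_line` with `φ = 0`,
`v = δ_w`, `t = 0`, and `Re(a · x · i) = −Im(a) x` for real `x`). [folklore] -/
theorem imGrad_hasDerivAt_re_genF_coord {r : ℕ} (c : Table r) (w : W r) :
    HasDerivAt (fun s : ℝ => (genF c (fun w' => (0 : ℝ) + s * (if w' = w then (1 : ℝ) else 0))).re)
      (-c.sum (fun n a => a.im * (n w : ℝ))) 0 := by
  have hD := cvxr_hasDerivAt_re_genF_line c (fun _ => (0 : ℝ))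
    (fun w' => if w' = w then (1 : ℝ) else 0) 0
  refine hD.congr_deriv ?_
  unfold Finsupp.sum
  rw [Complex.re_sum, ← Finset.sum_neg_distrib]
  refine Finset.sum_congr rfl fun n _ => ?_
  dsimp only
  have h0 : (∑ w', (n w' : ℝ) * ((0 : ℝ) + 0 * (if w' = w then (1 : ℝ) else 0))) = 0 := by simp
  rw [imGrad_frq_delta, h0, Complex.ofReal_zero, mul_zero, Complex.exp_zero, mul_one]
  simp [Complex.mul_re, Complex.mul_im]

/-- **Registered stub C7 `stub_imGradientZero` (verbatim signature): the imaginary gradient of the window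
weight vanishes at the constants.**  Under (N) `Σ_n c_n = 0` and (C) `c₀ ΣΣ(1 − cos(φ_w − φ_w')) ≤ Re F(φ)`
(`c₀ > 0`) the constant configuration minimises `Re F` (`Re F ≥ 0 = Re F(0)`), so the derivative of
`s ↦ Re genF c (s·δ_w)` vanishes at `0` (Fermat, `IsLocalMin.hasDerivAt_eq_zero`): `Σ_n Im(c_n)·n_w = 0`
for every window site `w`.  Hence the linear Taylor part of `genF c` at `0` is purely imaginary (the sector
Berry phase of chapter 2). [folklore] -/
theorem stub_imGradientZero :
    ∀ (r : ℕ) (c : Table r) (c₀ : ℝ), 0 < c₀ → c.sum (fun _ a => a) = 0 →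
      (∀ φ : W r → ℝ, c₀ * ∑ w, ∑ w', (1 - Real.cos (φ w - φ w')) ≤ (genF c φ).re) →
      ∀ w : W r, c.sum (fun n a => a.im * (n w : ℝ)) = 0 := by
  intro r c c₀ hc₀ hN hC w
  have hD := imGrad_hasDerivAt_re_genF_coord c w
  have hmin : IsLocalMin
      (fun s : ℝ => (genF c (fun w' => (0 : ℝ) + s * (if w' = w then (1 : ℝ) else 0))).re) 0 := by
    refine Filter.Eventually.of_forall fun s => ?_
    have h0 : (fun w' : W r => (0 : ℝ) + 0 * (if w' = w then (1 : ℝ) else 0)) = fun _ => 0 := by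
      funext w'
      simp
    show (genF c (fun w' => (0 : ℝ) + 0 * (if w' = w then (1 : ℝ) else 0))).re ≤
      (genF c (fun w' => (0 : ℝ) + s * (if w' = w then (1 : ℝ) else 0))).re
    rw [h0, imGrad_genF_const_zero c hN, Complex.zero_re]
    exact imGrad_re_genF_nonneg c hc₀.le hC _
  exact neg_eq_zero.1 (hmin.hasDerivAt_eq_zero hD)

end Summit.HubbardSuperconductivity.HubbardSuperconductivity.Theorems.FSUnfolding

end
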